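import Summits.BirchSwinnertonDyer.BirchSwinnertonDyer.Theorems.KatoDescentTamePotSupersingularTameUpperUnitTwistRecordToolsConductor
import Literature.NumberTheory.EllipticCurves.LocalTorsionMultiplicativeProofs
import Literature.NumberTheory.EllipticCurves.PastenValuationProductThm115Proofs
import Literature.NumberTheory.EllipticCurves.TamagawaNeZeroProofs
import HarnessLib

/-!
# Route `KatoDescentTamePotSupersingular` (rung K8, sub-rung B4 (t′), cell `bsd-potss`): a kernel TOOL for the per-row records —
# `q ∤ Tam(E)` from the integer model, for a prime `q ≥ 5` (seat `bsd-potss-k8t-c4` g15; route-free; 0 definitions, 0 named facts,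
# 0 `sorry`; closes nothing)

WHY. The ♭ unit-twist records of items 19202 / 19982 (g14, 188 rows) DISPLAY `htam : ¬ p ∣ W.tamagawaProduct`. For `p ≥ 5` this is
decided by the MULTIPLICATIVE primes alone, because every local Tamagawa number at an additive prime is `≤ 4` (Kodaira–Néron,
Silverman *ATAEC* Cor. IV.9.2, tree `localTamagawaNumber_padic_le_four` + `localTamagawaNumber_padic_ne_zero_holds`), a NON-SPLIT
multiplicative prime has `c ∈ {1, 2}` and a SPLIT one has `c_ℓ = ord_ℓ Δ_min` (tree `NeronComponentIndexSplitProofs`,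
`NonsplitProofs`, all PROVED). This file packages:
* `not_dvd_localTamagawaNumber_padic_of_addv` — `Addv W ℓ → 5 ≤ q → q ∤ c_ℓ`;
* `not_dvd_localTamagawaNumber_padic_of_mult_of_not_split` — `ℓ ∣ Δ(E₀)`, `ℓ ∤ c₄(E₀)`, the node-tangent quadratic of `E₀ mod ℓ` has
  no root, `3 ≤ q` → `q ∤ c_ℓ`;
* `not_dvd_localTamagawaNumber_padic_of_mult_of_not_dvd_ord` — `ℓ ∣ Δ(E₀)`, `ℓ ∤ c₄(E₀)`, `ℓⁿ ∥ Δ(E₀)`, `q ∤ n`, `3 ≤ q` → `q ∤ c_ℓ`;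
* `not_dvd_tamagawaProduct_of_forall` — assembly over the bad primes of a complete factorisation of `|Δ(E₀)|`
  (`tamagawaProduct_eq_prod`, good primes contribute `1`).

References: [SilvermanATAEC1994] Cor. IV.9.2, IV.9.4 Step 2, Table 4.1; [SilvermanAEC2009] VII.5.1, VII.6.1, C.16; [Cremona2006] Table 1.
-/

set_option autoImplicit false
-- the Theorems directory repeats the summit name (sibling precedent `KatoDescentPotSupersingularAssembly.lean`)
set_option linter.dupNamespace false

noncomputable section

open scoped Classical NumberField

namespace Summit.BirchSwinnertonDyer.BirchSwinnertonDyer.Theorems.TameUpperUnitTwistRecords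

open WeierstrassCurve WeierstrassCurve.Rat IsDedekindDomain Rat.HeightOneSpectrum NumberField
  Literature.NumberTheory.EllipticCurves Literature.NumberTheory.EllipticCurves.Rank1Residual
  Literature.NumberTheory.EllipticCurves.LocalTorsionMult
  Summit.BirchSwinnertonDyer.Rank1Residual Summit.BirchSwinnertonDyer.Rank1Residual.Additive
  Summit.BirchSwinnertonDyer.BirchSwinnertonDyer.Rank1Residual.IntModel
  Summit.BirchSwinnertonDyer.BirchSwinnertonDyer.Rank2Observatory.RootNumber

section Local

variable (W : WeierstrassCurve ℚ) [W.IsElliptic]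

/-- **At an ADDITIVE prime `ℓ`, no prime `q ≥ 5` divides `c_ℓ`**: `c_ℓ ≤ 4` for a curve whose minimal `ℤ_ℓ`-model is not split
multiplicative (Kodaira–Néron, Silverman *ATAEC* Cor. IV.9.2; tree `localTamagawaNumber_padic_le_four`) and `c_ℓ ≠ 0`
(`localTamagawaNumber_padic_ne_zero_holds`); `Addv W ℓ` excludes multiplicative reduction of that model.
[cite: SilvermanATAEC1994, Cor. IV.9.2 and Table 4.1] -/
theorem not_dvd_localTamagawaNumber_padic_of_addv (ℓ : ℕ) [Fact ℓ.Prime] (hadd : Addv W ℓ) {q : ℕ} (hq : 5 ≤ q) :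
    ¬ q ∣ (W.baseChange ℚ_[ℓ]).localTamagawaNumber ℤ_[ℓ] := by
  haveI : (W.baseChange ℚ_[ℓ]).IsElliptic := by unfold WeierstrassCurve.baseChange; infer_instance
  have hns : ¬ ((W.baseChange ℚ_[ℓ]).minimal ℤ_[ℓ]).HasSplitMultiplicativeReduction ℤ_[ℓ] :=
    fun hs ↦ hadd.2 (HasSplitMultiplicativeReductionAtPrime.hasMultiplicativeReductionAtPrime hs)
  have h4 := localTamagawaNumber_padic_le_four ℓ (W.baseChange ℚ_[ℓ]) hns
  have h0 := localTamagawaNumber_padic_ne_zero_holds ℓ (W.baseChange ℚ_[ℓ])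
  intro hd
  have := Nat.le_of_dvd (Nat.pos_of_ne_zero h0) hd
  omega

variable [W.IsGloballyMinimal] {E₀ : WeierstrassCurve ℤ} (hI : integralModelInt W = E₀)
include hI

/-- **At a NON-SPLIT multiplicative prime `ℓ`, no prime `q ≥ 3` divides `c_ℓ`** (`c_ℓ ≤ 4` off the split case, in fact `∈ {1,2}`;
Silverman *ATAEC* IV.9.4 Step 2): `ℓ ∣ Δ(E₀)`, `ℓ ∤ c₄(E₀)` and the node-tangent quadratic of `E₀ mod ℓ` has no root in `𝔽_ℓ`
(tree `IntModel.not_hasSplitMultiplicativeReductionAtPrime_of_intModel_of_noroot`), and `c_ℓ ∉ {3, 4}` because `c_ℓ ∈ {1, 2}`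
(`localTamagawaNumber_of_hasNonsplitMultiplicativeReductionAt_holds` at the place of `𝓞 ℚ` over `ℓ`, `localTamagawaNumber_padic_eq_holds`).
[cite: SilvermanATAEC1994, IV.9.4 Step 2 (PDF p. 344) and Rem. IV.9.3] [cite: SilvermanAEC2009, VII.5 Prop. 5.1(b)] -/
theorem not_dvd_localTamagawaNumber_padic_of_mult_of_not_split (ℓ : ℕ) [hℓ : Fact ℓ.Prime]
    (hΔ : (ℓ : ℤ) ∣ E₀.Δ) (hc₄ : ¬ (ℓ : ℤ) ∣ E₀.c₄)
    (hnoroot : ∀ t : ZMod ℓ, (E₀.c₄ : ZMod ℓ) * t ^ 2 + (E₀.a₁ * E₀.c₄ : ZMod ℓ) * t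
      - (54 * E₀.b₆ - 3 * E₀.b₂ * E₀.b₄ + E₀.a₂ * E₀.c₄ : ZMod ℓ) ≠ 0)
    {q : ℕ} (hq : 3 ≤ q) : ¬ q ∣ (W.baseChange ℚ_[ℓ]).localTamagawaNumber ℤ_[ℓ] := by
  have hmult : W.HasMultiplicativeReductionAtPrime ℓ := hasMultiplicativeReductionAtPrime_of_intModel hI ℓ hΔ hc₄
  have hnsp : ¬ W.HasSplitMultiplicativeReductionAtPrime ℓ :=
    not_hasSplitMultiplicativeReductionAtPrime_of_intModel_of_noroot hI ℓ hΔ hc₄ hnoroot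
  set v : HeightOneSpectrum (𝓞 ℚ) := (primesEquiv (R := 𝓞 ℚ)).symm ⟨ℓ, hℓ.out⟩ with hvdef
  have hv : primesEquiv v = ⟨ℓ, hℓ.out⟩ := Equiv.apply_symm_apply _ _
  have hvℓ : (primesEquiv v : ℕ) = ℓ := congrArg Subtype.val hv
  haveI : Finite (IsLocalRing.ResidueField (v.adicCompletionIntegers ℚ)) :=
    HeightOneSpectrum.finite_residueField_adicCompletionIntegers ℚ v
  have hmultv : W.HasMultiplicativeReductionAt v := by
    have key : ∀ q' : Nat.Primes, primesEquiv v = q' →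
        (haveI := Fact.mk q'.2; W.HasMultiplicativeReductionAtPrime (q' : ℕ)) → W.HasMultiplicativeReductionAt v := by
      rintro q' rfl h
      exact (hasMultiplicativeReductionAtPrime_iff_hasMultiplicativeReductionAt_ringOfIntegers W v).mp h
    exact key ⟨ℓ, hℓ.out⟩ hv hmult
  have hnsv : ¬ W.HasSplitMultiplicativeReductionAt v := by
    have key : ∀ q' : Nat.Primes, primesEquiv v = q' →
        ((haveI := Fact.mk q'.2; W.HasSplitMultiplicativeReductionAtPrime (q' : ℕ)) ↔ W.HasSplitMultiplicativeReductionAt v) := by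
      rintro q' rfl
      exact hasSplitMultiplicativeReductionAtPrime_iff_hasSplitMultiplicativeReductionAt W v
    exact fun hs ↦ hnsp ((key ⟨ℓ, hℓ.out⟩ hv).mpr hs)
  rw [localTamagawaNumber_padic_eq_holds W v ℓ hvℓ,
    localTamagawaNumber_of_hasNonsplitMultiplicativeReductionAt_holds v W hmultv hnsv]
  intro hd
  split_ifs at hd
  · have := Nat.le_of_dvd two_pos hd; omega
  · have := Nat.le_of_dvd one_pos hd; omega

/-- **At a multiplicative prime `ℓ` with `ℓⁿ ∥ Δ(E₀)` and `q ∤ n`, no prime `q ≥ 3` divides `c_ℓ`** (split: `c_ℓ = ord_ℓ Δ_min = n`,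
Kodaira–Néron, Silverman *AEC* VII.6.1 / *ATAEC* Cor. IV.9.2(d); non-split: `c_ℓ ∈ {1, 2}`).
[cite: SilvermanAEC2009, Thm VII.6.1] [cite: SilvermanATAEC1994, Cor. IV.9.2(d), IV.9.4 Step 2] -/
theorem not_dvd_localTamagawaNumber_padic_of_mult_of_not_dvd_ord (ℓ : ℕ) [hℓ : Fact ℓ.Prime]
    (hc₄ : ¬ (ℓ : ℤ) ∣ E₀.c₄) {n : ℕ} (hn : 1 ≤ n) (hΔn : (ℓ : ℤ) ^ n ∣ E₀.Δ) (hΔn' : ¬ (ℓ : ℤ) ^ (n + 1) ∣ E₀.Δ)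
    {q : ℕ} (hq : 3 ≤ q) (hqn : ¬ q ∣ n) : ¬ q ∣ (W.baseChange ℚ_[ℓ]).localTamagawaNumber ℤ_[ℓ] := by
  have hΔ : (ℓ : ℤ) ∣ E₀.Δ := (dvd_pow_self (ℓ : ℤ) (by omega)).trans hΔn
  have hmult : W.HasMultiplicativeReductionAtPrime ℓ := hasMultiplicativeReductionAtPrime_of_intModel hI ℓ hΔ hc₄
  set v : HeightOneSpectrum (𝓞 ℚ) := (primesEquiv (R := 𝓞 ℚ)).symm ⟨ℓ, hℓ.out⟩ with hvdef
  have hv : primesEquiv v = ⟨ℓ, hℓ.out⟩ := Equiv.apply_symm_apply _ _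
  have hvℓ : (primesEquiv v : ℕ) = ℓ := congrArg Subtype.val hv
  haveI : Finite (IsLocalRing.ResidueField (v.adicCompletionIntegers ℚ)) :=
    HeightOneSpectrum.finite_residueField_adicCompletionIntegers ℚ v
  have hmultv : W.HasMultiplicativeReductionAt v := by
    have key : ∀ q' : Nat.Primes, primesEquiv v = q' →
        (haveI := Fact.mk q'.2; W.HasMultiplicativeReductionAtPrime (q' : ℕ)) → W.HasMultiplicativeReductionAt v := by
      rintro q' rfl h
      exact (hasMultiplicativeReductionAtPrime_iff_hasMultiplicativeReductionAt_ringOfIntegers W v).mp h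
    exact key ⟨ℓ, hℓ.out⟩ hv hmult
  rw [localTamagawaNumber_padic_eq_holds W v ℓ hvℓ]
  by_cases hs : W.HasSplitMultiplicativeReductionAt v
  · rw [localTamagawaNumber_eq_ordMinimalDiscriminant_of_hasSplitMultiplicativeReductionAt v W hs,
      ordMinimalDiscriminant_eq_padicValInt W v hvℓ, minimalDiscriminantInt_eq hI,
      padicValInt_eq_of_dvd_of_not_dvd ℓ hΔn hΔn']
    exact hqn
  · rw [localTamagawaNumber_of_hasNonsplitMultiplicativeReductionAt_holds v W hmultv hs]
    intro hd
    split_ifs at hd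
    · have := Nat.le_of_dvd two_pos hd; omega
    · have := Nat.le_of_dvd one_pos hd; omega

/-- **Assembly: `q ∤ Tam(W)` from the bad primes.** For the globally minimal `W` with integer model `E₀`, a complete prime factorisation
`|Δ(E₀)| = ∏_{(ℓ,e) ∈ G} ℓᵉ`, and `q ∤ c_ℓ` (in Mathlib's `ℚ_ℓ`, `ℓ` running through the primes of `G`): `q ∤ Tam(W)` — the good primes
contribute `c = 1` (`tamagawaProduct_eq_prod`, Silverman *AEC* VII.5.1(a), C.16). [cite: SilvermanAEC2009, C.16 and VII.5 Prop. 5.1(a)] -/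
theorem not_dvd_tamagawaProduct_of_forall {G : List (ℕ × ℕ)}
    (hfac : E₀.Δ.natAbs = (G.map fun qe : ℕ × ℕ => qe.1 ^ qe.2).prod) (hGp : ∀ qe ∈ G, qe.1.Prime)
    {q : ℕ} (hq : q.Prime)
    (hloc : ∀ qe ∈ G, ∀ (r : Nat.Primes), (r : ℕ) = qe.1 →
      ¬ q ∣ (haveI := Fact.mk r.2; (W.baseChange ℚ_[r]).localTamagawaNumber ℤ_[r])) :
    ¬ q ∣ W.tamagawaProduct := by
  have hW : W = E₀.baseChange ℚ := by
    rw [← hI, WeierstrassCurve.baseChange, algebraMap_int_eq, map_integralModelInt]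
  -- the bad places
  let S : Finset (HeightOneSpectrum ℤ) := (G.map fun qe : ℕ × ℕ => natPlace qe.1).toFinset
  have hs : ∀ v, ¬ W.HasGoodReductionAt v → v ∈ S := by
    intro v hv
    by_contra hnot
    apply hv
    have hnd : ¬ ((natGenerator v : ℕ) : ℤ) ∣ E₀.Δ := by
      intro hd
      obtain ⟨qe, hqe, hq1⟩ := List.mem_map.mp (mem_of_prime_dvd_of_natAbs_eq_prod hfac hGp (prime_natGenerator v) hd)
      apply hnot
      rw [List.mem_toFinset, List.mem_map]
      exact ⟨qe, hqe, by rw [hq1, natPlace_natGenerator]⟩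
    rw [hW]
    exact hasGoodReductionAt_of_not_dvd hnd
  rw [tamagawaProduct_eq_prod W S hs]
  intro h
  obtain ⟨v, hv, hdvd⟩ := (Prime.dvd_finsetProd_iff (Nat.prime_iff.mp hq) _).mp h
  rw [List.mem_toFinset, List.mem_map] at hv
  obtain ⟨qe, hqe, rfl⟩ := hv
  exact hloc qe hqe (primesEquiv (natPlace qe.1)) (natGenerator_natPlace (hGp qe hqe)) hdvd

end Local

end Summit.BirchSwinnertonDyer.BirchSwinnertonDyer.Theorems.TameUpperUnitTwistRecords
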